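import Summits.Ventures.Crystal3D.Theorems.StickyWulffConstantCoaxialWallLawIncoherentCount
import Summits.Ventures.Crystal3D.Theorems.StickyWulffConstantCoaxialWallLawPayerTransCellPlaneExport
import Summits.Ventures.Crystal3D.Theorems.StickyWulffConstantGenericWallFloorCoveringRadius
import HarnessLib

/-!
# Incoherent translation pairs, rigid fillings II′: the deficit count LOCATED AT THE BOTTOM GRAIN'S BALLS

HONEST FRAMING. Venture `Summits/Ventures/Crystal3D` (cell `crystal3d-full`), helper `--supports` the crux
`CoaxialWallLaw` (stmt-Ventures-19481, line `WallLedgerF`, stub `stub_coaxialTwoSlabAdhesion`).  Rung credit only; F-C1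
not moved.  (F-MED (ii), cf-p1 g28 16:48:23Z, 19481-p2 g6:) `translate_deficit_ge_incoherent_rigid` (`…IncoherentCount`)
VERBATIM with the window sum RESTRICTED to the balls of the bottom grain `Λ₁` — the line tops the proof counts ARE
`Λ₁`-balls (`hTprop`), so nothing changes but the last subset step.  This is what lets the mirrored count for the top
grain be ADDED (disjoint balls): `…IncoherentTwoGrain`.
* `translate_deficit_ge_incoherent_rigid_grain`.  WHAT THIS IS NOT: arbitrary fillings; the stub; F-C1 not moved.
-/

noncomputable section

namespace Summit.Ventures.Crystal3D.Theorems

open Summit.Ventures.Crystal3D Finset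
open Literature.MathematicalPhysics.StatisticalMechanics (fccStacking barlowStacking constHagg contactDeficiency)
open scoped InnerProductSpace

open scoped Classical in
/-- **The deficit count for an incoherent translation pair with a rigid filling.**  See the module docstring. -/
theorem translate_deficit_ge_incoherent_rigid_grain
    (A : EuclideanSpace ℝ (Fin 3) ≃ₗᵢ[ℝ] EuclideanSpace ℝ (Fin 3)) (t₁ t₂ : EuclideanSpace ℝ (Fin 3))
    (hA : ∀ q ∈ fccStacking 1 (Real.sqrt (2 / 3)), ‖q + A.symm (t₂ - t₁)‖ ≠ 1)
    (X P₁ P₂ : Finset (EuclideanSpace ℝ (Fin 3))) (R₀ h ρ : ℝ)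
    (hR₀ : 10 ≤ R₀) (hh : 0 ≤ h) (hρ : R₀ ≤ ρ)
    (hX : ∀ p ∈ X, ∀ q ∈ X, p ≠ q → 1 ≤ dist p q)
    (hcell : ∀ p ∈ X, -(2 * R₀) ≤ p 2 ∧ p 2 ≤ h + 2 * R₀ ∧ p 0 ^ 2 + p 1 ^ 2 ≤ ρ ^ 2)
    (hP₁X : P₁ ⊆ X) (hP₂X : P₂ ⊆ X)
    (hP₁ : ∀ p, p ∈ P₁ ↔ (p ∈ (fun q => A q + t₁) '' fccStacking 1 (Real.sqrt (2 / 3)) ∧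
      -(2 * R₀) ≤ p 2 ∧ p 2 ≤ -R₀ ∧ p 0 ^ 2 + p 1 ^ 2 ≤ ρ ^ 2))
    (hP₂ : ∀ p, p ∈ P₂ ↔ (p ∈ (fun q => A q + t₂) '' fccStacking 1 (Real.sqrt (2 / 3)) ∧
      h + R₀ ≤ p 2 ∧ p 2 ≤ h + 2 * R₀ ∧ p 0 ^ 2 + p 1 ^ 2 ≤ ρ ^ 2))
    (hrig : ∀ x ∈ X, x ∈ (fun q => A q + t₁) '' fccStacking 1 (Real.sqrt (2 / 3)) ∨
      x ∈ (fun q => A q + t₂) '' fccStacking 1 (Real.sqrt (2 / 3))) :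
    2 * (Real.sqrt 2 / 4 * ∑ᶠ w ∈ {w ∈ fccStacking 1 (Real.sqrt (2 / 3)) | ‖w‖ = 1},
        |⟪w, A.symm (EuclideanSpace.single (2 : Fin 3) (1 : ℝ))⟫_ℝ|) * Real.pi * ρ ^ 2 -
        12 * (12 * Real.sqrt 2 * Real.pi + 36 * R₀ + 144) * ρ ≤
      ∑ z ∈ X.filter (fun z => (-R₀ - 2 ≤ z 2 ∧ z 2 ≤ h + R₀ + 2) ∧
          z ∈ (fun q => A q + t₁) '' fccStacking 1 (Real.sqrt (2 / 3))),
        ((12 : ℝ) - ((X.filter fun q => dist z q = 1).card : ℝ)) := by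
  set e₃ : EuclideanSpace ℝ (Fin 3) := EuclideanSpace.single (2 : Fin 3) (1 : ℝ) with he₃
  set Λ₁ := (fun q => A q + t₁) '' fccStacking 1 (Real.sqrt (2 / 3)) with hΛ₁
  set Λ₂ := (fun q => A q + t₂) '' fccStacking 1 (Real.sqrt (2 / 3)) with hΛ₂
  have hR₀3 : (3 : ℝ) ≤ R₀ := by linarith
  have hρ0 : (0 : ℝ) ≤ ρ := by linarith
  have hρ1 : (1 : ℝ) ≤ ρ := by linarith
  have hH : ∀ x ∈ X, x 2 ≤ h + 2 * R₀ := fun x hx => (hcell x hx).2.1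
  -- no cross contacts, distinct cosets
  have hcross : ∀ x ∈ Λ₁, ∀ y ∈ Λ₂, dist x y ≠ 1 := fun x hx y hy => movedFcc_dist_ne_one_of_coset A t₁ t₂ hA hx hy
  have hne12 : ∀ x ∈ Λ₁, ∀ y ∈ Λ₂, x ≠ y := fun x hx y hy => movedFcc_ne_of_coset A t₁ t₂ hA hx hy
  -- rising roots
  set RT := fccSlots.filter (fun r => 0 < (A r) 2) with hRTdef
  have hRTS : ∀ r ∈ RT, r ∈ fccSlots := fun r hr => (mem_filter.1 hr).1
  have hRTup : ∀ r ∈ RT, 0 < (A r) 2 := fun r hr => (mem_filter.1 hr).2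
  have hRTcard : (RT.card : ℝ) ≤ 12 := by
    have : RT.card ≤ 12 := (card_le_card (filter_subset _ _)).trans (by rw [card_fccSlots])
    exact_mod_cast this
  -- the inner sample
  set zcut : ℝ := h + R₀ + 1 with hzcut
  set P' : Finset (EuclideanSpace ℝ (Fin 3)) := P₁.filter fun p =>
    -(2 * R₀) + 1 ≤ p 2 ∧ p 2 ≤ -R₀ - 1 ∧ p 0 ^ 2 + p 1 ^ 2 ≤ (ρ - 1) ^ 2 with hP'def
  have hP'iff : ∀ p, p ∈ P' ↔ (p ∈ Λ₁ ∧ -(2 * R₀) + 1 ≤ p 2 ∧ p 2 ≤ -R₀ - 1 ∧ p 0 ^ 2 + p 1 ^ 2 ≤ (ρ - 1) ^ 2) := by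
    intro p
    rw [hP'def, mem_filter, hP₁]
    constructor
    · rintro ⟨⟨hΛ, -, -, -⟩, h1, h2, h3⟩; exact ⟨hΛ, h1, h2, h3⟩
    · rintro ⟨hΛ, h1, h2, h3⟩
      have hρ1' : (0 : ℝ) ≤ ρ - 1 := by linarith
      exact ⟨⟨hΛ, by linarith, by linarith, by nlinarith⟩, h1, h2, h3⟩
  have hP'X : P' ⊆ X := fun p hp => hP₁X (mem_filter.1 hp).1
  -- the rim band near the bottom of the top sample
  set B := X.filter fun s => zcut ≤ s 2 ∧ s 2 ≤ zcut + 1 ∧ (ρ - 2) ^ 2 < s 0 ^ 2 + s 1 ^ 2 with hB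
  have hrimB : (B.card : ℝ) ≤ 144 * ρ := by
    have hsep : ∀ p ∈ B, ∀ q ∈ B, p ≠ q → 1 ≤ dist p q :=
      fun p hp q hq hpq => hX p (mem_filter.1 hp).1 q (mem_filter.1 hq).1 hpq
    have hmem : ∀ p ∈ B, zcut ≤ p 2 ∧ p 2 ≤ zcut + 1 ∧ (ρ - 2) ^ 2 < p 0 ^ 2 + p 1 ^ 2 ∧
        p 0 ^ 2 + p 1 ^ 2 ≤ ρ ^ 2 := by
      intro p hp
      obtain ⟨hpX, h1, h2, h3⟩ := mem_filter.1 hp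
      exact ⟨h1, h2, h3, (hcell p hpX).2.2⟩
    have key := card_mul_le_of_separated_in_shell B hsep zcut (zcut + 1) (ρ - 2) ρ (by linarith)
      (by linarith) (by linarith) hmem
    have e : (zcut + 1 - zcut + 2) * (Real.pi * (ρ + 1) ^ 2 - Real.pi * (ρ - 2 - 1) ^ 2) =
        (Real.pi / 6) * (144 * ρ - 144) := by ring
    rw [e] at key
    have hπ : 0 < Real.pi / 6 := by positivity
    have := le_of_mul_le_mul_right (by linarith [key] : (B.card : ℝ) * (Real.pi / 6) ≤
      (144 * ρ - 144) * (Real.pi / 6)) hπ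
    linarith
  -- INTERIOR OF THE COMPLETE TOP SAMPLE: a `Λ₁`-ball of height in `[zcut, zcut + 1]` lies in the rim band
  have hband : ∀ x ∈ X, x ∈ Λ₁ → zcut ≤ x 2 → x 2 ≤ zcut + 1 → x ∈ B := by
    intro x hx hx₁ hz1 hz2
    rw [hB, mem_filter]
    refine ⟨hx, hz1, hz2, ?_⟩
    by_contra hrad
    push Not at hrad
    -- a `Λ₂`-site within distance `< 1` of `x`, inside the top sample ⇒ in `X` ⇒ contradiction with separation
    obtain ⟨y₀, hy₀, hd⟩ := exists_mem_barlowStacking_dist_lt_one constHagg (A.symm (x - t₂))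
    set y : EuclideanSpace ℝ (Fin 3) := A y₀ + t₂ with hy
    have hyΛ : y ∈ Λ₂ := ⟨y₀, hy₀, rfl⟩
    have hdxy : dist x y < 1 := by
      have e : x - y = A (A.symm (x - t₂) - y₀) := by
        rw [map_sub, A.apply_symm_apply, hy]; abel
      rw [dist_eq_norm, e, LinearIsometryEquiv.norm_map, ← dist_eq_norm]; exact hd
    have hyx : dist y x < 1 := by rw [dist_comm]; exact hdxy
    -- height and radius of `y`
    have hy2 : |y 2 - x 2| < 1 := by
      have h1 : |(y - x) 2| ≤ ‖y - x‖ := by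
        rw [apply_two_eq_inner_e₃]
        calc |⟪y - x, e₃⟫_ℝ| ≤ ‖y - x‖ * ‖e₃‖ := abs_real_inner_le_norm _ _
          _ = ‖y - x‖ := by rw [he₃, PiLp.norm_single, norm_one, mul_one]
      rw [← dist_eq_norm] at h1
      have : (y - x) 2 = y 2 - x 2 := by rw [PiLp.sub_apply]
      rw [this] at h1
      linarith
    obtain ⟨hy2a, hy2b⟩ := abs_lt.1 hy2
    have hyrad : Real.sqrt (y 0 ^ 2 + y 1 ^ 2) ≤ ρ - 1 := by
      have h1 := lateral_radius_le_add_dist y x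
      have h2 : Real.sqrt (x 0 ^ 2 + x 1 ^ 2) ≤ ρ - 2 := by
        rw [← Real.sqrt_sq (by linarith : (0 : ℝ) ≤ ρ - 2)]
        exact Real.sqrt_le_sqrt hrad
      linarith
    have hyrad' : y 0 ^ 2 + y 1 ^ 2 ≤ ρ ^ 2 := by
      have e4 := Real.sq_sqrt (by positivity : (0 : ℝ) ≤ y 0 ^ 2 + y 1 ^ 2)
      have e5 : (0 : ℝ) ≤ Real.sqrt (y 0 ^ 2 + y 1 ^ 2) := Real.sqrt_nonneg _
      nlinarith
    have hyP₂ : y ∈ P₂ := by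
      rw [hP₂]
      exact ⟨hyΛ, by rw [hzcut] at hz1; linarith, by rw [hzcut] at hz2; linarith, hyrad'⟩
    have := hX x hx y (hP₂X hyP₂) (hne12 x hx₁ y hyΛ)
    linarith
  -- PER ROOT: sources, tops
  -- the source set of root `u`
  set S : EuclideanSpace ℝ (Fin 3) → Finset (EuclideanSpace ℝ (Fin 3)) := fun u =>
    P'.filter fun p => (∀ w ∈ fccSlots, p + A w ∈ X) ∧ -R₀ - 1 < (p + A u) 2 ∧ (p + A u) 2 < zcut with hSdef
  have hScount : ∀ u ∈ RT, Real.sqrt 2 * (A u) 2 * Real.pi * (ρ - 1) ^ 2 -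
      10 * Real.sqrt 2 * Real.pi * (ρ - 1) - 36 * R₀ * ρ ≤ ((S u).card : ℝ) := by
    intro u hu
    have key := card_vertical_tops_ge A t₁ X P₁ P' R₀ ρ zcut hR₀3 hρ (by rw [hzcut]; linarith)
      hX hP₁X hP₁ hP'iff (hRTS u hu) (by rw [← apply_two_eq_inner_e₃]; exact (hRTup u hu).le)
    rw [← apply_two_eq_inner_e₃, abs_of_pos (hRTup u hu)] at key
    exact key
  -- walk points are `Λ₁`-points
  have hwalkΛ : ∀ u ∈ RT, ∀ p ∈ P', ∀ j : ℕ, p + (j : ℝ) • A u ∈ Λ₁ := by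
    intro u hu p hp j
    have hpΛ : p ∈ Λ₁ := ((hP'iff p).1 hp).1
    have : (j : ℝ) • A u = A (((j : ℤ) : ℝ) • u) := by
      rw [LinearIsometryEquiv.map_smul]; norm_cast
    rw [this]
    exact movedFcc_add_site_mem A t₁ hpΛ (fcc_zsmul_mem j (mem_fcc_of_mem_fccSlots (hRTS u hu)))
  -- sources on one line are unique
  have hline : ∀ u ∈ RT, ∀ p ∈ S u, ∀ p' ∈ S u, ∀ j j' : ℕ,
      p + (j : ℝ) • A u = p' + (j' : ℝ) • A u → p = p' := by
    intro u hu p hp p' hp' j j' heq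
    have hα := hRTup u hu
    obtain ⟨hpP', -, hpw, -⟩ := mem_filter.1 hp
    obtain ⟨hp'P', -, hp'w, -⟩ := mem_filter.1 hp'
    have hp2 := ((hP'iff p).1 hpP').2.2.1
    have hp'2 := ((hP'iff p').1 hp'P').2.2.1
    rw [PiLp.add_apply] at hpw hp'w
    have hh2 : p 2 + (j : ℝ) * (A u) 2 = p' 2 + (j' : ℝ) * (A u) 2 := by
      have := congrArg (fun v : EuclideanSpace ℝ (Fin 3) => v 2) heq
      simp only [apply_two_add_real_smul] at this
      exact this
    rcases lt_trichotomy j j' with hlt | heq' | hgt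
    · exfalso
      have : (j : ℝ) + 1 ≤ j' := by exact_mod_cast hlt
      nlinarith
    · subst heq'
      have := congrArg (fun v : EuclideanSpace ℝ (Fin 3) => v - (j : ℝ) • A u) heq
      simpa using this
    · exfalso
      have : (j' : ℝ) + 1 ≤ j := by exact_mod_cast hgt
      nlinarith
  -- the top of each source
  have htop : ∀ u ∈ RT, ∀ p ∈ S u, ∃ k : ℕ, 1 ≤ k ∧ (∀ j : ℕ, j ≤ k → p + (j : ℝ) • A u ∈ X) ∧
      p + (k : ℝ) • A u + A u ∉ X := by
    intro u hu p hp
    obtain ⟨hpP', hfull, -, -⟩ := mem_filter.1 hp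
    exact exists_lineTop X hH A (hRTup u hu) (hP'X hpP') (hfull u (hRTS u hu))
  choose! kf hk1 hkgood hktop using htop
  -- the walk stays below `zcut + 1` unless it meets the rim band
  have hdich : ∀ u ∈ RT, ∀ p ∈ S u, (p + (kf u p : ℝ) • A u) 2 ≤ zcut + 1 ∨
      ∃ j : ℕ, j ≤ kf u p ∧ p + (j : ℝ) • A u ∈ B := by
    intro u hu p hp
    by_cases hle : (p + (kf u p : ℝ) • A u) 2 ≤ zcut + 1
    · exact Or.inl hle
    · right
      push Not at hle
      have hα := hRTup u hu
      have hα1 : (A u) 2 ≤ 1 := by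
        have := abs_inner_slot_le_one A (hRTS u hu)
        rw [← apply_two_eq_inner_e₃] at this
        exact (abs_le.1 this).2
      obtain ⟨hpP', -, -, -⟩ := mem_filter.1 hp
      have hp2 := ((hP'iff p).1 hpP').2.2.1
      -- the first index reaching height `zcut`
      have hex : ∃ j : ℕ, zcut ≤ (p + (j : ℝ) • A u) 2 := ⟨kf u p, by linarith⟩
      set j₀ := Nat.find hex with hj₀
      have hj₀spec : zcut ≤ (p + (j₀ : ℝ) • A u) 2 := Nat.find_spec hex
      have hj₀le : j₀ ≤ kf u p := Nat.find_le (by linarith)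
      have hj₀pos : 1 ≤ j₀ := by
        by_contra h0
        push Not at h0
        have : j₀ = 0 := by omega
        rw [this, Nat.cast_zero, zero_smul, add_zero] at hj₀spec
        rw [hzcut] at hj₀spec; linarith
      have hprev : (p + ((j₀ - 1 : ℕ) : ℝ) • A u) 2 < zcut := by
        have := Nat.find_min hex (show j₀ - 1 < j₀ by omega)
        push Not at this
        exact this
      have hup1 : (p + (j₀ : ℝ) • A u) 2 ≤ zcut + 1 := by
        rw [apply_two_add_real_smul] at hprev ⊢
        have : ((j₀ : ℕ) : ℝ) = ((j₀ - 1 : ℕ) : ℝ) + 1 := by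
          rw [show j₀ = (j₀ - 1) + 1 by omega]; push_cast; ring
        rw [this]; nlinarith
      refine ⟨j₀, hj₀le, hband _ (hkgood u hu p hp j₀ hj₀le) (hwalkΛ u hu p hpP' j₀) hj₀spec hup1⟩
  -- good sources: the top is in the window
  set G : EuclideanSpace ℝ (Fin 3) → Finset (EuclideanSpace ℝ (Fin 3)) := fun u =>
    (S u).filter fun p => (p + (kf u p : ℝ) • A u) 2 ≤ zcut + 1 with hGdef
  -- bad sources inject into the rim band
  have hbad : ∀ u ∈ RT, ((S u).card : ℝ) ≤ ((G u).card : ℝ) + (B.card : ℝ) := by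
    intro u hu
    have hsplit := Finset.card_filter_add_card_filter_not (s := S u)
      (fun p => (p + (kf u p : ℝ) • A u) 2 ≤ zcut + 1)
    -- choose a rim ball for each bad source
    have hb : ∀ p ∈ (S u).filter (fun p => ¬ (p + (kf u p : ℝ) • A u) 2 ≤ zcut + 1),
        ∃ j : ℕ, j ≤ kf u p ∧ p + (j : ℝ) • A u ∈ B := by
      intro p hp
      obtain ⟨hpS, hnot⟩ := mem_filter.1 hp
      rcases hdich u hu p hpS with h' | h'
      · exact absurd h' hnot
      · exact h'
    choose! jb hjble hjbB using hb
    have hinj : ((S u).filter (fun p => ¬ (p + (kf u p : ℝ) • A u) 2 ≤ zcut + 1)).card ≤ B.card := by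
      refine Finset.card_le_card_of_injOn (fun p => p + (jb p : ℝ) • A u) (fun p hp => hjbB p hp) ?_
      intro p hp p' hp' heq
      exact hline u hu p (mem_filter.1 (mem_coe.1 hp)).1 p' (mem_filter.1 (mem_coe.1 hp')).1 _ _ heq
    have h1 : (S u).card ≤ ((S u).filter fun p => (p + (kf u p : ℝ) • A u) 2 ≤ zcut + 1).card + B.card := by
      omega
    have h1' : (S u).card ≤ (G u).card + B.card := h1
    exact_mod_cast h1'
  -- the tops of good sources
  set T : EuclideanSpace ℝ (Fin 3) → Finset (EuclideanSpace ℝ (Fin 3)) := fun u =>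
    (G u).image fun p => p + (kf u p : ℝ) • A u with hTdef
  set W := X.filter (fun z => -R₀ - 2 ≤ z 2 ∧ z 2 ≤ h + R₀ + 2) with hW
  set W₁ := X.filter (fun z => (-R₀ - 2 ≤ z 2 ∧ z 2 ≤ h + R₀ + 2) ∧ z ∈ Λ₁) with hW₁
  have hTcard : ∀ u ∈ RT, (T u).card = (G u).card := by
    intro u hu
    rw [hTdef]
    refine card_image_of_injOn ?_
    intro p hp p' hp' heq
    exact hline u hu p (mem_filter.1 (mem_coe.1 hp)).1 p' (mem_filter.1 (mem_coe.1 hp')).1 _ _ heq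
  have hTprop : ∀ u ∈ RT, ∀ t ∈ T u, t ∈ W ∧ t ∈ Λ₁ ∧ t + A u ∉ X := by
    intro u hu t ht
    obtain ⟨p, hp, rfl⟩ := mem_image.1 ht
    obtain ⟨hpS, htop⟩ := mem_filter.1 hp
    obtain ⟨hpP', -, hpw, -⟩ := mem_filter.1 hpS
    refine ⟨mem_filter.2 ⟨hkgood u hu p hpS _ le_rfl, ?_, by rw [hzcut] at htop; linarith⟩,
      hwalkΛ u hu p hpP' _, hktop u hu p hpS⟩
    -- lower window bound: the top is at least one step above the source
    have h1 := hk1 u hu p hpS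
    have hα := hRTup u hu
    rw [PiLp.add_apply] at hpw
    rw [apply_two_add_real_smul]
    have : (1 : ℝ) ≤ (kf u p : ℝ) := by exact_mod_cast h1
    nlinarith
  -- DOUBLE COUNTING: a ball topping `m` directions has `m` distinct empty slots
  have hdeg : ∀ z ∈ W, ((RT.filter fun u => z ∈ T u).card : ℝ) ≤
      (12 : ℝ) - ((X.filter fun q => dist z q = 1).card : ℝ) := by
    intro z hz
    by_cases hemp : (RT.filter fun u => z ∈ T u) = ∅
    · rw [hemp, card_empty, Nat.cast_zero]
      have := card_filter_dist_eq_one_le_twelve X hX z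
      have : ((X.filter fun q => dist z q = 1).card : ℝ) ≤ 12 := by exact_mod_cast this
      linarith
    · obtain ⟨u₀, hu₀⟩ := nonempty_iff_ne_empty.2 hemp
      obtain ⟨hu₀RT, hzu₀⟩ := mem_filter.1 hu₀
      obtain ⟨hzW, hzΛ, -⟩ := hTprop u₀ hu₀RT z hzu₀
      have hzX : z ∈ X := (mem_filter.1 hzW).1
      -- contacts of `z` are exactly its occupied slots
      have hN : (X.filter fun q => dist z q = 1) = (fccSlots.filter fun w => z + A w ∈ X).image fun w => z + A w := by
        ext q
        rw [mem_filter, mem_image]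
        constructor
        · rintro ⟨hq, hd⟩
          rcases hrig q hq with hq₁ | hq₂
          · obtain ⟨z', hz', hzz'⟩ := hzΛ
            obtain ⟨q', hq', hqq'⟩ := hq₁
            simp only at hzz' hqq'
            have hw : A.symm (q - z) ∈ fccSlots := by
              refine mem_fccSlots_of_unit ?_ ?_
              · have e : A.symm (q - z) = q' - z' := by
                  apply A.injective
                  rw [A.apply_symm_apply, map_sub, ← hqq', ← hzz']; abel
                rw [e]; exact fcc_sub_site_mem hq' hz'
              · rw [LinearIsometryEquiv.norm_map, ← dist_eq_norm, dist_comm]; exact hd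
            refine ⟨A.symm (q - z), mem_filter.2 ⟨hw, ?_⟩, ?_⟩
            · rw [A.apply_symm_apply, add_sub_cancel]; exact hq
            · rw [A.apply_symm_apply, add_sub_cancel]
          · exact absurd hd (hcross z hzΛ q hq₂)
        · rintro ⟨w, hw, rfl⟩
          obtain ⟨hwS, hwX⟩ := mem_filter.1 hw
          refine ⟨hwX, ?_⟩
          rw [dist_eq_norm, show z - (z + A w) = -A w by abel, norm_neg, LinearIsometryEquiv.norm_map,
            norm_eq_one_of_mem_fccSlots hwS]
      have hinjw : Set.InjOn (fun w => z + A w) ↑(fccSlots.filter fun w => z + A w ∈ X) := by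
        intro w _ w' _ h
        exact A.injective (add_left_cancel h)
      rw [hN, card_image_of_injOn hinjw]
      have hsplit := Finset.card_filter_add_card_filter_not (s := fccSlots) (fun w => z + A w ∈ X)
      rw [card_fccSlots] at hsplit
      have hsub : (RT.filter fun u => z ∈ T u) ⊆ fccSlots.filter (fun w => ¬ z + A w ∈ X) := by
        intro u hu
        obtain ⟨huRT, hzu⟩ := mem_filter.1 hu
        exact mem_filter.2 ⟨hRTS u huRT, (hTprop u huRT z hzu).2.2⟩
      have h1 := card_le_card hsub
      have h2 : ((RT.filter fun u => z ∈ T u).card : ℝ) ≤ ((fccSlots.filter fun w => ¬ z + A w ∈ X).card : ℝ) := by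
        exact_mod_cast h1
      have h3 : ((fccSlots.filter fun w => z + A w ∈ X).card : ℝ) +
          ((fccSlots.filter fun w => ¬ z + A w ∈ X).card : ℝ) = 12 := by exact_mod_cast hsplit
      linarith
  have hdouble : ∑ u ∈ RT, ((T u).card : ℝ) ≤ ∑ z ∈ W₁, ((12 : ℝ) - ((X.filter fun q => dist z q = 1).card : ℝ)) := by
    have hTW : ∀ u ∈ RT, T u ⊆ W₁ := fun u hu t ht => by
      obtain ⟨htW, htΛ, -⟩ := hTprop u hu t ht
      exact mem_filter.2 ⟨(mem_filter.1 htW).1, (mem_filter.1 htW).2, htΛ⟩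
    have hW₁W : W₁ ⊆ W := fun z hz => mem_filter.2 ⟨(mem_filter.1 hz).1, (mem_filter.1 hz).2.1⟩
    have e1 : ∀ u ∈ RT, ((T u).card : ℝ) = ∑ z ∈ W₁, if z ∈ T u then (1 : ℝ) else 0 := by
      intro u hu
      rw [← sum_filter, filter_mem_eq_inter, inter_eq_right.2 (hTW u hu)]
      simp
    rw [sum_congr rfl e1, sum_comm]
    refine sum_le_sum fun z hz => ?_
    have e2 : (∑ u ∈ RT, if z ∈ T u then (1 : ℝ) else 0) = ((RT.filter fun u => z ∈ T u).card : ℝ) := by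
      rw [← sum_filter]; simp
    rw [e2]; exact hdeg z (hW₁W hz)
  -- ARITHMETIC
  have h2 : 0 ≤ Real.sqrt 2 := Real.sqrt_nonneg _
  have hπ : 0 ≤ Real.pi := Real.pi_pos.le
  have h2π : 0 ≤ Real.sqrt 2 * Real.pi * ρ := mul_nonneg (mul_nonneg h2 hπ) hρ0
  have hper : ∀ u ∈ RT, Real.sqrt 2 * (A u) 2 * Real.pi * ρ ^ 2 - (12 * Real.sqrt 2 * Real.pi + 36 * R₀) * ρ - (B.card : ℝ) ≤
      ((T u).card : ℝ) := by
    intro u hu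
    have hs := hScount u hu
    have hb := hbad u hu
    rw [hTcard u hu]
    set α := (A u) 2 with hα
    have hα0 : 0 ≤ α := (hRTup u hu).le
    have hαle : α ≤ 1 := by
      have := abs_inner_slot_le_one A (hRTS u hu)
      rw [← apply_two_eq_inner_e₃] at this
      exact (abs_le.1 this).2
    have hsq : Real.sqrt 2 * α * Real.pi * (ρ - 1) ^ 2 ≥ Real.sqrt 2 * α * Real.pi * ρ ^ 2 - 2 * Real.sqrt 2 * Real.pi * ρ := by
      have e : Real.sqrt 2 * α * Real.pi * (ρ - 1) ^ 2 = Real.sqrt 2 * α * Real.pi * ρ ^ 2 -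
          2 * Real.sqrt 2 * α * Real.pi * ρ + Real.sqrt 2 * α * Real.pi := by ring
      rw [e]
      have h1 : Real.sqrt 2 * α * Real.pi * ρ ≤ Real.sqrt 2 * Real.pi * ρ := by
        have := mul_le_mul_of_nonneg_left hαle h2π
        have e1 : Real.sqrt 2 * α * Real.pi * ρ = Real.sqrt 2 * Real.pi * ρ * α := by ring
        rw [mul_one] at this; rw [e1]; exact this
      have h3 : 0 ≤ Real.sqrt 2 * α * Real.pi := mul_nonneg (mul_nonneg h2 hα0) hπ
      linarith
    have h10 : 10 * Real.sqrt 2 * Real.pi * (ρ - 1) ≤ 10 * Real.sqrt 2 * Real.pi * ρ := by nlinarith only [h2π, h2, hπ]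
    linarith only [hs, hb, hsq, h10, h2π]
  have hsum := sum_le_sum hper
  rw [sum_sub_distrib, sum_sub_distrib, sum_const, sum_const, nsmul_eq_mul, nsmul_eq_mul, ← sum_mul, ← sum_mul,
    ← mul_sum] at hsum
  have hflux : Real.sqrt 2 * ∑ u ∈ RT, (A u) 2 = 2 * (Real.sqrt 2 / 4 * ∑ᶠ w ∈ {w ∈ fccStacking 1 (Real.sqrt (2 / 3)) | ‖w‖ = 1},
      |⟪w, A.symm e₃⟫_ℝ|) := sqrt_two_mul_sum_rising_eq_two_phi A
  have hK0 : 0 ≤ (12 * Real.sqrt 2 * Real.pi + 36 * R₀ + 144) * ρ := by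
    have : 0 ≤ 12 * Real.sqrt 2 * Real.pi + 36 * R₀ + 144 := by positivity
    exact mul_nonneg this hρ0
  have hloss : (RT.card : ℝ) * ((12 * Real.sqrt 2 * Real.pi + 36 * R₀) * ρ) + (RT.card : ℝ) * (B.card : ℝ) ≤
      12 * (12 * Real.sqrt 2 * Real.pi + 36 * R₀ + 144) * ρ := by
    have hc0 : (0 : ℝ) ≤ RT.card := Nat.cast_nonneg _
    have h1 : (RT.card : ℝ) * ((12 * Real.sqrt 2 * Real.pi + 36 * R₀) * ρ) + (RT.card : ℝ) * (B.card : ℝ) ≤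
        (RT.card : ℝ) * ((12 * Real.sqrt 2 * Real.pi + 36 * R₀ + 144) * ρ) := by
      have := mul_le_mul_of_nonneg_left hrimB hc0
      nlinarith only [this]
    have h2 := mul_le_mul_of_nonneg_right hRTcard hK0
    linarith only [h1, h2]
  rw [← hflux]
  linarith only [hsum, hloss, hdouble]

end Summit.Ventures.Crystal3D.Theorems

end
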